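import Summits.RiemannHypothesis.RiemannHypothesis.Theses.SpectralTrace
import Literature.NumberTheory.LFunctions.WeilArchimedeanPositivityProofs
import Literature.NumberTheory.LFunctions.WeilArchimedeanMoments
import Literature.NumberTheory.LFunctions.WeilSmallSupportPositivity
import Literature.NumberTheory.LFunctions.WeilGroundState
import Literature.NumberTheory.LFunctions.WeilMellinInversion
import HarnessLib

/-!
# `WindowTraceArch` — negative lemma: no bounded local counting, no separated spectrum, no lattice

Support lemmas for the crux `stmt-RiemannHypothesis-11195`
(`Summit.RiemannHypothesis.RiemannHypothesis.Theses.SpectralTrace.WindowTraceArch`), recorded by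
the standing disprover (`Cruxes/WindowTraceArch/Disproof.lean` §2), sharpening
`Negative/FiniteSpectrum.lean` (every witness is infinite) to a DENSITY statement.

* `not_bounded_localCount_of_windowTrace` : if a real family `γ : ι → ℝ` reproduces the Weil
  functional on every Weil test supported in `[-A, A]` (`A > 0`), then there is NO uniform
  bound `D` such that every unit cell `[k, k+1)`, `k ∈ ℤ`, holds at most `D` indices.
  Proof: let `f(u) = ĝ(1/2 + iu)` for a thin `L²`-normalised test `g` (`supp g ⊆ [-a, a]`,
  `a ≤ 1`). The `L¹` Sobolev bound on a unit cell, applied to `f²`, gives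
  `|f(x)|² ≤ ∫_k^{k+1} (2|f|² + |f'|²)` for `x ∈ [k, k+1]`, hence
  `Σ_i |f(γ_i)|² ≤ D ∫_ℝ (2|f|² + |f'|²) = 2πD (2‖g‖₂² + ‖t·g‖₂²) ≤ 6πD`
  (Plancherel `integral_norm_sq_weilMellin_half_line`; `f' = i (t g)^`), whereas
  `Σ_i |f(γ_i)|² = Q(g) ≥ (19D + 1)‖g‖₂²` for `a` small (`weilMellin_weilConv_weilReflect_half`,
  Bombieri's coercivity `weilQuadratic_coercive`, `exists_isWeilTest_sphere`).
* `exists_crowded_cell_of_windowTrace` : the same, positively: for every `D` some unit cell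
  holds more than `D` points (or infinitely many).
* `not_separated_of_windowTrace` : no witness is `δ`-separated (uniformly discrete) — so no
  Delone set, no uniformly discrete Fourier quasicrystal / model set;
  `not_windowTrace_lattice` : no arithmetic progression `a + bℤ`, `b ≠ 0`.
* `…_of_windowTraceArch_witness`, `not_windowTraceArch_lattice` : the crux window `log 2`.

These are unconditional consequences of the window identity ALONE (no arithmetic input): the
local density of any witness is unbounded, consistent with the forced Riemann–von Mangoldt
growth `#{i : |γ_i - T| ≤ 1} ≍ log T` of the zeta ordinates.
-/

noncomputable section

open Complex Set MeasureTheory Filter intervalIntegral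
open scoped Real Topology

namespace Summit.RiemannHypothesis.RiemannHypothesis.Theorems.WindowTraceArch.Negative

open Literature.NumberTheory.LFunctions

/-! ### An `L¹` Sobolev bound on unit intervals -/

/-- For `F` with a continuous derivative `F'` and `x ∈ [c, c+1]`:
`‖F x‖ ≤ ∫_c^{c+1} ‖F‖ + ∫_c^{c+1} ‖F'‖`. [folklore] -/
theorem norm_le_intervalIntegral_add {F F' : ℝ → ℂ} (hF : ∀ x, HasDerivAt F (F' x) x)
    (hFc : Continuous F) (hF'c : Continuous F') {c x : ℝ} (hx : x ∈ Icc c (c + 1)) :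
    ‖F x‖ ≤ (∫ y in c..c + 1, ‖F y‖) + ∫ y in c..c + 1, ‖F' y‖ := by
  have hc1 : c ≤ c + 1 := by linarith
  set J : ℝ := ∫ y in c..c + 1, ‖F' y‖ with hJ
  have hnn : 0 ≤ᵐ[volume.restrict (Ioc c (c + 1))] fun t => ‖F' t‖ :=
    Eventually.of_forall fun _ => norm_nonneg _
  -- pointwise in `y`: `‖F x‖ ≤ ‖F y‖ + J`
  have hpt : ∀ y ∈ Icc c (c + 1), ‖F x‖ ≤ ‖F y‖ + J := by
    intro y hy
    have hFTC : ∫ t in y..x, F' t = F x - F y :=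
      integral_eq_sub_of_hasDerivAt (fun t _ => hF t) (hF'c.intervalIntegrable _ _)
    have h1 : ‖F x - F y‖ ≤ J := by
      rw [← hFTC]
      rcases le_total y x with hyx | hxy
      · calc ‖∫ t in y..x, F' t‖ ≤ ∫ t in y..x, ‖F' t‖ := norm_integral_le_integral_norm hyx
          _ ≤ J := integral_mono_interval hy.1 hyx hx.2 hnn (hF'c.norm.intervalIntegrable _ _)
      · rw [integral_symm, norm_neg]
        calc ‖∫ t in x..y, F' t‖ ≤ ∫ t in x..y, ‖F' t‖ := norm_integral_le_integral_norm hxy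
          _ ≤ J := integral_mono_interval hx.1 hxy hy.2 hnn (hF'c.norm.intervalIntegrable _ _)
    calc ‖F x‖ = ‖F y + (F x - F y)‖ := by rw [add_sub_cancel]
      _ ≤ ‖F y‖ + ‖F x - F y‖ := norm_add_le _ _
      _ ≤ ‖F y‖ + J := by linarith
  -- integrate over `y ∈ [c, c+1]`
  have hint : (∫ _ in c..c + 1, ‖F x‖) ≤ ∫ y in c..c + 1, (‖F y‖ + J) :=
    integral_mono_on hc1 intervalIntegrable_const
      ((hFc.norm.intervalIntegrable _ _).add intervalIntegrable_const) hpt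
  rw [intervalIntegral.integral_const,
    intervalIntegral.integral_add (hFc.norm.intervalIntegrable _ _) intervalIntegrable_const,
    intervalIntegral.integral_const] at hint
  simpa using hint

/-- The square of a `C¹` function on a unit interval:
`‖f x‖² ≤ ∫_c^{c+1} (2‖f‖² + ‖f'‖²)` for `x ∈ [c, c+1]` (apply the `L¹` bound to `F = f²`,
`F' = 2 f f'`, and `2|f||f'| ≤ |f|² + |f'|²`). [folklore] -/
theorem norm_sq_le_intervalIntegral {f f' : ℝ → ℂ} (hf : ∀ x, HasDerivAt f (f' x) x)
    (hfc : Continuous f) (hf'c : Continuous f') {c x : ℝ} (hx : x ∈ Icc c (c + 1)) :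
    ‖f x‖ ^ 2 ≤ ∫ y in c..c + 1, (2 * ‖f y‖ ^ 2 + ‖f' y‖ ^ 2) := by
  have hc1 : c ≤ c + 1 := by linarith
  have hF : ∀ x, HasDerivAt (fun y => f y * f y) (f' x * f x + f x * f' x) x := fun x =>
    (hf x).mul (hf x)
  have h := norm_le_intervalIntegral_add hF (hfc.mul hfc) ((hf'c.mul hfc).add (hfc.mul hf'c)) hx
  rw [norm_mul, ← sq] at h
  refine h.trans ?_
  have hi1 : IntervalIntegrable (fun y => ‖f y * f y‖) volume c (c + 1) :=
    (hfc.mul hfc).norm.intervalIntegrable _ _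
  have hi2 : IntervalIntegrable (fun y => ‖f' y * f y + f y * f' y‖) volume c (c + 1) :=
    ((hf'c.mul hfc).add (hfc.mul hf'c)).norm.intervalIntegrable _ _
  rw [← intervalIntegral.integral_add hi1 hi2]
  refine intervalIntegral.integral_mono_on hc1 (hi1.add hi2) ?_ fun y _ => ?_
  · exact ((continuous_const.mul (hfc.norm.pow 2)).add (hf'c.norm.pow 2)).intervalIntegrable _ _
  · have h2 : ‖f' y * f y + f y * f' y‖ ≤ ‖f' y‖ * ‖f y‖ + ‖f y‖ * ‖f' y‖ :=
      (norm_add_le _ _).trans (by rw [norm_mul, norm_mul])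
    rw [norm_mul, ← sq]
    nlinarith [sq_nonneg (‖f y‖ - ‖f' y‖), norm_nonneg (f y), norm_nonneg (f' y)]

/-! ### The derivative of `u ↦ ĝ(1/2 + iu)` -/

/-- `t ↦ t g(t)` is a Weil test function. [folklore] -/
theorem isWeilTest_mul_id {g : ℝ → ℂ} (hg : IsWeilTest g) : IsWeilTest fun t : ℝ => (t : ℂ) * g t :=
  ⟨Complex.ofRealCLM.contDiff.mul hg.1, hg.2.mul_left⟩

/-- `d/du ĝ(1/2 + iu) = i · (t g)^(1/2 + iu)`. [folklore] -/
theorem hasDerivAt_weilMellin_line {g : ℝ → ℂ} (hg : IsWeilTest g) (u : ℝ) :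
    HasDerivAt (fun v : ℝ => weilMellin g (1 / 2 + v * I))
      (I * weilMellin (fun t : ℝ => (t : ℂ) * g t) (1 / 2 + u * I)) u := by
  have h1 : HasDerivAt (fun v : ℝ => (1 / 2 : ℂ) + (v : ℂ) * I) I u := by
    simpa using ((hasDerivAt_id u).ofReal_comp.mul_const I).const_add (1 / 2 : ℂ)
  have h2 := hasDerivAt_weilMellin hg.1.continuous hg.2 (1 / 2 + u * I)
  have h3 : HasDerivAt (weilMellin g ∘ fun v : ℝ => (1 / 2 : ℂ) + (v : ℂ) * I)
      ((∫ t : ℝ, g t * (t * cexp ((1 / 2 + u * I - 1 / 2) * t))) * I) u := h2.comp u h1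
  have h4 : HasDerivAt (fun v : ℝ => weilMellin g (1 / 2 + v * I))
      ((∫ t : ℝ, g t * (t * cexp ((1 / 2 + u * I - 1 / 2) * t))) * I) u := h3
  refine h4.congr_deriv ?_
  rw [mul_comm, weilMellin]
  congr 1
  refine integral_congr_ae (Eventually.of_forall fun t => ?_)
  simp only
  ring

/-! ### No window-trace family has bounded local counting -/

/-- **A window-trace family has unbounded local counting.** If a real family `γ : ι → ℝ`
reproduces the Weil functional on every Weil test supported in `[-A, A]` (`A > 0`), then for
every `D : ℕ` some unit cell `[k, k+1)` (`k ∈ ℤ`) contains more than `D` points of the family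
(precisely: it is false that every cell's points fit in a finset of size `≤ D`). In particular
the spectrum is not uniformly discrete, not a finite union of lattices, and not of bounded
Beurling upper density: the log-growth of the local density is forced.
Proof: with `f(u) = ĝ(1/2+iu)`, the `L¹` Sobolev bound on unit cells gives
`Σ_i |f(γ_i)|² ≤ D ∫ (2|f|² + |f'|²) = 2πD (2‖g‖₂² + ‖t g‖₂²) ≤ 6πD ‖g‖₂²` for `supp g ⊆ [-a,a]`,
`a ≤ 1` (Plancherel `integral_norm_sq_weilMellin_half_line`), while `Σ_i |f(γ_i)|² = Q(g)`
(`weilMellin_weilConv_weilReflect_half`) and `Q(g) ≥ (19 D + 1)‖g‖₂²` for `a` small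
(`weilQuadratic_coercive`). [folklore] -/
theorem not_bounded_localCount_of_windowTrace {A : ℝ} (hA : 0 < A) {ι : Type*} {γ : ι → ℝ}
    (h : ∀ g : ℝ → ℂ, IsWeilTest g → tsupport g ⊆ Icc (-A) A →
      HasSum (fun i => weilMellin g (1 / 2 + (γ i : ℂ) * I)) (weilFunctional g)) (D : ℕ) :
    ¬ ∀ k : ℤ, ∃ s : Finset ι, s.card ≤ D ∧ ∀ i, γ i ∈ Set.Ico (k : ℝ) (k + 1) → i ∈ s := by
  intro hD
  classical
  choose S hScard hSmem using hD
  -- a thin test on the unit sphere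
  obtain ⟨a₀, ha₀, hco⟩ := weilQuadratic_coercive (19 * (D : ℝ) + 1)
  set a : ℝ := min a₀ (min 1 (A / 2)) with ha_def
  have ha : 0 < a := lt_min ha₀ (lt_min one_pos (half_pos hA))
  have haa₀ : a ≤ a₀ := min_le_left _ _
  have ha1 : a ≤ 1 := (min_le_right _ _).trans (min_le_left _ _)
  have haA : a ≤ A / 2 := (min_le_right _ _).trans (min_le_right _ _)
  obtain ⟨g, hg, hgs, hnorm⟩ := exists_isWeilTest_sphere ha
  have hN : weilNorm2Sq g = 1 := hnorm
  -- coercivity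
  have hlow : (19 * (D : ℝ) + 1) * ∫ t, ‖g t‖ ^ 2 ≤ (weilQuadratic g).re := hco a ha haa₀ g hg hgs
  rw [hnorm, mul_one] at hlow
  -- the trace identity for `k = g ⋆ g̃`, in real form
  have hk : IsWeilTest (weilConv g (weilReflect g)) := hg.weilConv hg.weilReflect
  have hks : tsupport (weilConv g (weilReflect g)) ⊆ Icc (-A) A :=
    (tsupport_weilConv_weilReflect_subset hg.2 hgs).trans
      (Icc_subset_Icc (by linarith) (by linarith))
  have hsumC : HasSum (fun i => (((‖weilMellin g (1 / 2 + (γ i : ℂ) * I)‖ ^ 2 : ℝ) : ℂ)))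
      (weilFunctional (weilConv g (weilReflect g))) := by
    simpa only [weilMellin_weilConv_weilReflect_half hg] using h _ hk hks
  have hsumR : HasSum (fun i => ‖weilMellin g (1 / 2 + (γ i : ℂ) * I)‖ ^ 2)
      (weilFunctional (weilConv g (weilReflect g))).re := by
    simpa only [Complex.reCLM_apply, Complex.ofReal_re] using hsumC.mapL Complex.reCLM
  rw [weilQuadratic] at hlow
  -- notation for the line function and its derivative
  set f : ℝ → ℂ := fun v => weilMellin g (1 / 2 + v * I) with hf_def
  set gh : ℝ → ℂ := fun t => (t : ℂ) * g t with hgh_def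
  have hgh : IsWeilTest gh := isWeilTest_mul_id hg
  set f' : ℝ → ℂ := fun v => I * weilMellin gh (1 / 2 + v * I) with hf'_def
  have hder : ∀ v, HasDerivAt f (f' v) v := fun v => hasDerivAt_weilMellin_line hg v
  have hfc : Continuous f :=
    (continuous_weilMellin hg.1.continuous hg.2).comp (by fun_prop)
  have hf'c : Continuous f' :=
    continuous_const.mul ((continuous_weilMellin hgh.1.continuous hgh.2).comp (by fun_prop))
  set φ : ℝ → ℝ := fun v => 2 * ‖f v‖ ^ 2 + ‖f' v‖ ^ 2 with hφ_def
  have hφc : Continuous φ := (continuous_const.mul (hfc.norm.pow 2)).add (hf'c.norm.pow 2)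
  have hφnn : ∀ v, 0 ≤ φ v := fun v => by positivity
  -- integrability and the value of `∫ φ`
  have hif : Integrable fun v => ‖f v‖ ^ 2 := integrable_norm_sq_weilMellin_half_line hg
  have hif' : Integrable fun v => ‖f' v‖ ^ 2 := by
    have := integrable_norm_sq_weilMellin_half_line hgh
    refine this.congr (Eventually.of_forall fun v => ?_)
    simp [hf'_def]
  have hiφ : Integrable φ := (hif.const_mul 2).add hif'
  have hgh2 : weilNorm2Sq gh ≤ a ^ 2 * weilNorm2Sq g := by
    unfold weilNorm2Sq
    rw [← MeasureTheory.integral_const_mul]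
    refine integral_mono hgh.integrable_norm_sq (hg.integrable_norm_sq.const_mul _) fun t => ?_
    · by_cases ht : t ∈ tsupport g
      · have ht' := hgs ht
        simp only [hgh_def, norm_mul, Complex.norm_real, Real.norm_eq_abs, mul_pow, sq_abs]
        have : t ^ 2 ≤ a ^ 2 := by nlinarith [ht'.1, ht'.2]
        exact mul_le_mul_of_nonneg_right this (sq_nonneg _)
      · simp [hgh_def, image_eq_zero_of_notMem_tsupport ht]
  have hB : ∫ v, φ v ≤ 19 := by
    have e1 : ∫ v, ‖f v‖ ^ 2 = 2 * π * weilNorm2Sq g := integral_norm_sq_weilMellin_half_line hg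
    have e2 : ∫ v, ‖f' v‖ ^ 2 = 2 * π * weilNorm2Sq gh := by
      rw [← integral_norm_sq_weilMellin_half_line hgh]
      refine integral_congr_ae (Eventually.of_forall fun v => ?_)
      simp [hf'_def]
    show ∫ v, (2 * ‖f v‖ ^ 2 + ‖f' v‖ ^ 2) ≤ 19
    rw [integral_add (hif.const_mul 2) hif', MeasureTheory.integral_const_mul, e1, e2, hN]
    have hpi := Real.pi_lt_d2
    have hgh2' : weilNorm2Sq gh ≤ 1 := by nlinarith
    nlinarith [Real.pi_pos, weilNorm1_nonneg gh]
  -- the cells: `b k = ∫_k^{k+1} φ`, summing to `∫ φ`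
  set b : ℤ → ℝ := fun k => ∫ v in (k : ℝ)..(k : ℝ) + 1, φ v with hb_def
  have hb_nonneg : ∀ k, 0 ≤ b k := fun k =>
    intervalIntegral.integral_nonneg (by linarith) fun v _ => hφnn v
  have hbsum : HasSum b (∫ v, φ v) := by
    have h1 := hasSum_integral_iUnion (μ := volume) (f := φ)
      (s := fun k : ℤ => Ioc (k : ℝ) (k + 1)) (fun k => measurableSet_Ioc)
      (pairwise_disjoint_Ioc_intCast ℝ) (hiφ.integrableOn)
    rw [iUnion_Ioc_intCast, setIntegral_univ] at h1
    refine h1.congr_fun fun k => ?_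
    show (∫ v in (k : ℝ)..(k : ℝ) + 1, φ v) = ∫ v in Ioc (k : ℝ) (k + 1), φ v
    exact intervalIntegral.integral_of_le (by linarith)
  -- pointwise Sobolev: `‖f x‖² ≤ b ⌊x⌋`
  have hpt : ∀ x : ℝ, ‖f x‖ ^ 2 ≤ b ⌊x⌋ := fun x =>
    norm_sq_le_intervalIntegral hder hfc hf'c
      ⟨Int.floor_le x, (Int.lt_floor_add_one x).le⟩
  -- finite partial sums are `≤ D · ∫ φ`
  have hfin : ∀ s : Finset ι, ∑ i ∈ s, ‖f (γ i)‖ ^ 2 ≤ D * ∫ v, φ v := by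
    intro s
    set t : Finset ℤ := s.image fun i => ⌊γ i⌋ with ht_def
    have hmaps : ∀ i ∈ s, ⌊γ i⌋ ∈ t := fun i hi => Finset.mem_image_of_mem _ hi
    rw [← Finset.sum_fiberwise_of_maps_to hmaps]
    calc ∑ k ∈ t, ∑ i ∈ s with ⌊γ i⌋ = k, ‖f (γ i)‖ ^ 2
        ≤ ∑ k ∈ t, ∑ i ∈ s with ⌊γ i⌋ = k, b k := by
          refine Finset.sum_le_sum fun k _ => Finset.sum_le_sum fun i hi => ?_
          rw [Finset.mem_filter] at hi
          rw [← hi.2]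
          exact hpt (γ i)
      _ = ∑ k ∈ t, ((s.filter fun i => ⌊γ i⌋ = k).card : ℝ) * b k := by
          simp [Finset.sum_const, nsmul_eq_mul]
      _ ≤ ∑ k ∈ t, (D : ℝ) * b k := by
          refine Finset.sum_le_sum fun k _ => mul_le_mul_of_nonneg_right ?_ (hb_nonneg k)
          have hsub : (s.filter fun i => ⌊γ i⌋ = k) ⊆ S k := by
            intro i hi
            rw [Finset.mem_filter] at hi
            exact hSmem k i (Int.floor_eq_iff.1 hi.2)
          exact_mod_cast (Finset.card_le_card hsub).trans (hScard k)
      _ = (D : ℝ) * ∑ k ∈ t, b k := by rw [Finset.mul_sum]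
      _ ≤ (D : ℝ) * ∫ v, φ v :=
          mul_le_mul_of_nonneg_left (sum_le_hasSum t (fun k _ => hb_nonneg k) hbsum)
            (Nat.cast_nonneg D)
  -- hence `Q(g) ≤ 19 D`, contradicting coercivity
  have hup : (weilFunctional (weilConv g (weilReflect g))).re ≤ D * ∫ v, φ v :=
    hasSum_le_of_sum_le hsumR hfin
  have hD19 : (D : ℝ) * ∫ v, φ v ≤ D * 19 := mul_le_mul_of_nonneg_left hB (Nat.cast_nonneg D)
  linarith

/-! ### Corollaries: crowded cells; no separated (uniformly discrete) spectrum; no lattice -/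

/-- **Some unit cell is arbitrarily crowded.** For a window-trace family and every `D`, there
is a cell `[k, k+1)` whose indices fit in no finset of size `≤ D` (the cell holds more than
`D` points, or infinitely many). [folklore] -/
theorem exists_crowded_cell_of_windowTrace {A : ℝ} (hA : 0 < A) {ι : Type*} {γ : ι → ℝ}
    (h : ∀ g : ℝ → ℂ, IsWeilTest g → tsupport g ⊆ Icc (-A) A →
      HasSum (fun i => weilMellin g (1 / 2 + (γ i : ℂ) * I)) (weilFunctional g)) (D : ℕ) :
    ∃ k : ℤ, ∀ s : Finset ι, (∀ i, γ i ∈ Set.Ico (k : ℝ) (k + 1) → i ∈ s) → D < s.card := by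
  by_contra hcon
  refine not_bounded_localCount_of_windowTrace hA h D fun k => ?_
  obtain ⟨s, hs⟩ := not_forall.1 (not_exists.1 hcon k)
  obtain ⟨hmem, hcard⟩ := Classical.not_imp.1 hs
  exact ⟨s, not_lt.1 hcard, hmem⟩

/-- A `δ`-separated real family has at most `⌊1/δ⌋₊ + 1` points in each unit cell
(pigeonhole on `i ↦ ⌊(γ_i - k)/δ⌋₊`). [folklore] -/
theorem exists_finset_cell_of_separated {ι : Type*} {γ : ι → ℝ} {δ : ℝ} (hδ : 0 < δ)
    (hsep : Pairwise fun i j => δ ≤ |γ i - γ j|) (k : ℤ) :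
    ∃ s : Finset ι, s.card ≤ ⌊1 / δ⌋₊ + 1 ∧ ∀ i, γ i ∈ Set.Ico (k : ℝ) (k + 1) → i ∈ s := by
  classical
  set C : Set ι := {i | γ i ∈ Set.Ico (k : ℝ) (k + 1)} with hC
  set φ : ι → ℕ := fun i => ⌊(γ i - k) / δ⌋₊ with hφ
  have hinj : Set.InjOn φ C := by
    intro i hi j hj hij
    by_contra hne
    have hs : δ ≤ |γ i - γ j| := hsep hne
    have hi0 : 0 ≤ (γ i - k) / δ := div_nonneg (by linarith [hi.1]) hδ.le
    have hj0 : 0 ≤ (γ j - k) / δ := div_nonneg (by linarith [hj.1]) hδ.le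
    obtain ⟨h1, h2⟩ := (Nat.floor_eq_iff hi0).1 rfl
    obtain ⟨h3, h4⟩ := (Nat.floor_eq_iff hj0).1 rfl
    have hij' : (⌊(γ i - k) / δ⌋₊ : ℝ) = ⌊(γ j - k) / δ⌋₊ := by exact_mod_cast hij
    have hlt : |(γ i - k) / δ - (γ j - k) / δ| < 1 := by
      rw [abs_lt]; constructor <;> linarith
    have heq : (γ i - k) / δ - (γ j - k) / δ = (γ i - γ j) / δ := by ring
    rw [heq, abs_div, abs_of_pos hδ, div_lt_one hδ] at hlt
    linarith
  have hmaps : Set.MapsTo φ C (Finset.range (⌊1 / δ⌋₊ + 1) : Finset ℕ) := by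
    intro i hi
    rw [Finset.coe_range, Set.mem_Iio, Nat.lt_add_one_iff]
    refine Nat.floor_le_floor ?_
    rw [div_le_div_iff_of_pos_right hδ]
    linarith [hi.2]
  have hfin : C.Finite :=
    Set.Finite.of_finite_image ((Finset.finite_toSet _).subset hmaps.image_subset) hinj
  refine ⟨hfin.toFinset, ?_, fun i hi => hfin.mem_toFinset.2 hi⟩
  have hcard := Finset.card_le_card_of_injOn φ (s := hfin.toFinset)
    (t := Finset.range (⌊1 / δ⌋₊ + 1)) (fun i hi => hmaps (hfin.mem_toFinset.1 hi))
    (fun i hi j hj hij => hinj (hfin.mem_toFinset.1 hi) (hfin.mem_toFinset.1 hj) hij)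
  simpa using hcard

/-- **No uniformly discrete (separated) spectrum.** A window-trace family (`A > 0`) is never
`δ`-separated for any `δ > 0`: in particular it is not a Delone set, not a finite-density model
set / Fourier quasicrystal with uniformly discrete support, and (next lemma) not a lattice.
[folklore] -/
theorem not_separated_of_windowTrace {A : ℝ} (hA : 0 < A) {ι : Type*} {γ : ι → ℝ}
    (h : ∀ g : ℝ → ℂ, IsWeilTest g → tsupport g ⊆ Icc (-A) A →
      HasSum (fun i => weilMellin g (1 / 2 + (γ i : ℂ) * I)) (weilFunctional g))
    {δ : ℝ} (hδ : 0 < δ) : ¬ Pairwise fun i j => δ ≤ |γ i - γ j| := fun hsep =>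
  not_bounded_localCount_of_windowTrace hA h (⌊1 / δ⌋₊ + 1)
    (exists_finset_cell_of_separated hδ hsep)

/-- **No lattice / arithmetic progression `a + bℤ` (`b ≠ 0`) is a window-trace family**
(Poisson summation would make its transform a Dirac comb; here it falls to the separation
bound directly). [folklore] -/
theorem not_windowTrace_lattice {A : ℝ} (hA : 0 < A) (a b : ℝ) (hb : b ≠ 0) :
    ¬ ∀ g : ℝ → ℂ, IsWeilTest g → tsupport g ⊆ Icc (-A) A →
      HasSum (fun n : ℤ => weilMellin g (1 / 2 + ((a + b * n : ℝ) : ℂ) * I))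
        (weilFunctional g) := by
  intro h
  refine not_separated_of_windowTrace hA (γ := fun n : ℤ => a + b * n) h (abs_pos.2 hb) ?_
  intro i j hij
  have h1 : (1 : ℝ) ≤ |(i : ℝ) - j| := by
    rw [← Int.cast_sub, ← Int.cast_abs]
    exact_mod_cast Int.one_le_abs (sub_ne_zero.2 hij)
  have h2 : |(a + b * i) - (a + b * j)| = |b| * |(i : ℝ) - j| := by
    rw [← abs_mul]; congr 1; ring
  rw [h2]
  nlinarith [abs_nonneg b]

/-- The crux window `[-log 2, log 2]`: no bounded local counting, no separated spectrum,
no lattice. [folklore] -/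
theorem not_separated_of_windowTraceArch_witness {ι : Type} {γ : ι → ℝ}
    (h : ∀ g : ℝ → ℂ, IsWeilTest g → tsupport g ⊆ Icc (-Real.log 2) (Real.log 2) →
      HasSum (fun i => weilMellin g (1 / 2 + (γ i : ℂ) * I)) (weilFunctional g))
    {δ : ℝ} (hδ : 0 < δ) : ¬ Pairwise fun i j => δ ≤ |γ i - γ j| :=
  not_separated_of_windowTrace (Real.log_pos one_lt_two) h hδ

/-- The crux window: for every `D` some unit cell holds more than `D` spectral points.
[folklore] -/
theorem exists_crowded_cell_of_windowTraceArch_witness {ι : Type} {γ : ι → ℝ}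
    (h : ∀ g : ℝ → ℂ, IsWeilTest g → tsupport g ⊆ Icc (-Real.log 2) (Real.log 2) →
      HasSum (fun i => weilMellin g (1 / 2 + (γ i : ℂ) * I)) (weilFunctional g)) (D : ℕ) :
    ∃ k : ℤ, ∀ s : Finset ι, (∀ i, γ i ∈ Set.Ico (k : ℝ) (k + 1) → i ∈ s) → D < s.card :=
  exists_crowded_cell_of_windowTrace (Real.log_pos one_lt_two) h D

/-- The crux window: no arithmetic progression `a + bℤ` (`b ≠ 0`) is a witness. [folklore] -/
theorem not_windowTraceArch_lattice (a b : ℝ) (hb : b ≠ 0) :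
    ¬ ∀ g : ℝ → ℂ, IsWeilTest g → tsupport g ⊆ Icc (-Real.log 2) (Real.log 2) →
      HasSum (fun n : ℤ => weilMellin g (1 / 2 + ((a + b * n : ℝ) : ℂ) * I))
        (weilFunctional g) :=
  not_windowTrace_lattice (Real.log_pos one_lt_two) a b hb

end Summit.RiemannHypothesis.RiemannHypothesis.Theorems.WindowTraceArch.Negative

end
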